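import Summits.ResolutionOfSingularities.ResolutionOfSingularities.Theorems.EquisingularLiftEquisingularLiftNatNonEquimultipleChartPrimes
import Summits.ResolutionOfSingularities.ResolutionOfSingularities.Theorems.EquisingularLiftEquisingularLiftNatCoheightTwoPrime
import Summits.ResolutionOfSingularities.ResolutionOfSingularities.Theorems.EquisingularLiftEquisingularLiftNatInCarrierStepFlatRing
import Literature.AlgebraicGeometry.Resolution.EtaleLocalAlgebra
import Literature.AlgebraicGeometry.Resolution.Dehomogenization
import Literature.AlgebraicGeometry.Resolution.WeightedInitialTerms
import Literature.AlgebraicGeometry.Resolution.AlterationsSectionDivisor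
import Literature.AlgebraicGeometry.Resolution.StalkIdealLemmas
import Literature.AlgebraicGeometry.Resolution.QuasiRegularSequences
import HarnessLib

/-!
# [OURS · L1 W4.5(b) · EL♮(3)] E-NEG(1), part (iv)(a-1) — the stalk algebra at `R = 𝒪_{X,q}`: from «order `m` along the section but `> m` at the
# point» to the two comparable chart primes of the restricted centre (crux `EquisingularLiftNatThree` = stmt-ResolutionOfSingularities-20148,
# parent stmt-20038)

NOT a statement of any manuscript. Helper file of the chain res-L1-w45b (cell `res-hironaka`, rung L, slot W4.5(b)); AI-written, weaker than
expert review; filed `--supports stmt-ResolutionOfSingularities-20148 --as helper`; it closes nothing. Object (O1) E-NEG(1) of res-L1-w45b-plan-1's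
PLANNER-MEMO-g9-1 v1.1, conclusion (iv) «`D♭` is EQUIMULTIPLE along `s`» (res-L1-w45b-plan-1 WORD 2026-08-27T15:36:49Z (2): (iv)(a) = stub-4).

THE STATEMENT (`stalkIdeal_le_sup_pow_of_exactShadow_of_frame'`). In the frame currency of part 3b-ii (`…NatExactShadowStalk`, p538737: the
exact-shadow SETTING of part 2, `D♭ := τ(supp C)` horizontal, a non-closed `ζ ⤳ q` of the curve, an ideal sheaf `J ⊇`-planar and irreducible
with `supp J ⊄ D♭`, and at `q = s(s₀)`: `R = 𝒪_{X₁,q}` regular of dimension `4`, `J_q = (c₀)`, `c₀ ∉ 𝔪²`, the uniformizer germ `ϖ_R ∉ 𝔪² + (c₀)`,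
`(ker s)_q = (c₀, x₁, x₂)`), with `s` moreover a SECTION of the separated `τ₁ ≫ r`: for every `n`,
**`𝓘(D♭)_q ≤ (c₀) + (ϖ_R) + 𝔪ⁿ ⟹ 𝓘(D♭)_q ≤ (c₀) + (ker s)_qⁿ`** — the order of the special fibre `D♭_k` at `q` (inside the carrier plane
`E_k`) does not exceed the order of `D♭` along the section (the reverse inequality being trivial): the lift passes through the section WITH ITS FULL
MULTIPLICITY.

PROOF (assembly). In the carrier germ `A = R/(c₀)` (regular of dimension `3`) the prime of `D♭` is `(g)` (p534378 / p537428: coheight two ⇒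
principal); by induction on `n`, `g = Φ(x̄)` with `Φ` a form of degree `n − 1` over the section coordinates `x̄ = (x̄₁, x̄₂)`; if `g ∉ (x̄)ⁿ` then `Φ̄ ≠ 0`
over `A/(x̄) ≅ O` while `ḡ ∈ 𝔪̄ⁿ` puts every coefficient of `Φ` in `(x̄) + (ϖ̄)` (the coefficient criterion of part (iv)(c-2),
`coeff_mem_sup_span_of_eval_mem`, quasi-regularity of `x̄` modulo `ϖ̄` from the regular surface germ `R/(c₀, ϖ_R)`); part (iv)(c-2)
`exists_chartPrimes_of_forall_coeff_mem` (over res-L1-w45b-stub-2's ring core p543997) then yields two comparable primes of the chart algebra of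
the restricted centre at the point of `V(D♭)_red` under `q`, which part (iv)(c-1) `not_chartPrimes_of_exactShadow` (p545525, with
res-L1-w45b-stub-2's p544313) forbids under `hfib`.

References: H. Matsumura, *Commutative Ring Theory* (1986), §16, Thms. 14.2, 17.4; The Stacks Project, Tags 080E, 0804, 07Z3 — through the cited tree
files. OURS planning text (index only): L/w45b/PLANNER-MEMO-g9-1.md v1.1 §1 (iv).
-/

set_option linter.dupNamespace false -- mandated namespace `Summit.<Summit>.<Problem>` of this single-conjunct summit
set_option linter.overlappingInstances false -- signatures carry `[IsDomain O] [IsDiscreteValuationRing O]`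

noncomputable section

open CategoryTheory AlgebraicGeometry TopologicalSpace Topology IsLocalRing MvPolynomial
open AlgebraicGeometry.Scheme.IdealSheafData Literature.AlgebraicGeometry.Resolution

namespace Summit.ResolutionOfSingularities.ResolutionOfSingularities.Cruxes.EquisingularLiftNat.Sections

/-! ## Algebra: quasi-regularity modulo the uniformizer, and the induction step -/

section Algebra

universe u

variable {A : Type u} [CommRing A] [IsRegularLocalRing A]

/-- In a regular local ring `A` with `(x̄₁, x̄₂) + (ϖ) = 𝔪` and `ϖ ∉ 𝔪²`, `A/ϖ` regular of dimension `2`: the reductions of `x̄` modulo `ϖ` form a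
regular system of parameters of `A/ϖ`, hence a quasi-regular sequence. [cite: Matsumura1987, Thm. 14.2, Thm. 16.2] [folklore] -/
theorem isQuasiRegular_mk_of_sup_span_eq (h3 : ringKrullDim A = (3 : ℕ)) (xb : Fin 2 → A) {ϖ : A} (hϖ : ϖ ∈ maximalIdeal A)
    (hϖ2 : ϖ ∉ maximalIdeal A ^ 2) (h𝔪 : Ideal.span (Set.range xb) ⊔ Ideal.span {ϖ} = maximalIdeal A) :
    IsQuasiRegular (fun l => Ideal.Quotient.mk (Ideal.span {ϖ}) (xb l)) := by
  classical
  obtain ⟨hA₂, hdim₂⟩ := IsRegularLocalRing.quotient_span_singleton hϖ hϖ2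
  haveI := hA₂
  set π := Ideal.Quotient.mk (Ideal.span ({ϖ} : Set A)) with hπ
  have hsurj : Function.Surjective π := Ideal.Quotient.mk_surjective
  have h2 : ringKrullDim (A ⧸ Ideal.span {ϖ}) = (2 : ℕ) := by
    obtain ⟨m, hm⟩ := exists_nat_cast_eq_ringKrullDim (R := A ⧸ Ideal.span {ϖ})
    rw [hm, h3] at hdim₂
    rw [hm]
    have h' : ((m + 1 : ℕ) : WithBot ℕ∞) = ((3 : ℕ) : WithBot ℕ∞) := by rw [← hdim₂]; push_cast; rfl
    have h'' : m + 1 = 3 := by exact_mod_cast h'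
    have : m = 2 := by omega
    rw [this]
  -- the maximal ideal of `A/ϖ` is generated by the reductions of `x̄`
  have hmax : Ideal.span (Set.range fun l => π (xb l)) = maximalIdeal (A ⧸ Ideal.span {ϖ}) := by
    rw [← map_maximalIdeal_of_surjective π hsurj, ← h𝔪, Ideal.map_sup, Ideal.map_span, Ideal.map_span, Set.image_singleton,
      ← Set.range_comp]
    have h0 : π ϖ = 0 := Ideal.Quotient.eq_zero_iff_mem.mpr (Ideal.mem_span_singleton_self ϖ)
    rw [h0, Ideal.span_singleton_eq_bot.mpr rfl, sup_bot_eq]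
    rfl
  refine ((isRsopPart_iff_quotient _).mpr ⟨fun l => ?_, ?_, ?_⟩).isQuasiRegular
  · rw [← hmax]; exact Ideal.subset_span ⟨l, rfl⟩
  · haveI : (Ideal.span (Set.range fun l => π (xb l))).IsMaximal := by rw [hmax]; exact maximalIdeal.isMaximal _
    letI := Ideal.Quotient.field (Ideal.span (Set.range fun l => π (xb l)))
    infer_instance
  · haveI : (Ideal.span (Set.range fun l => π (xb l))).IsMaximal := by rw [hmax]; exact maximalIdeal.isMaximal _
    letI := Ideal.Quotient.field (Ideal.span (Set.range fun l => π (xb l)))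
    rw [ringKrullDim_eq_zero_of_isField (Field.toIsField _), h2, zero_add]

/-- **The coefficient criterion at the ambient germ.** `A` regular local of dimension `3` with `(x̄) + (ϖ) = 𝔪`, `ϖ ∉ 𝔪²`; a form `Φ` of degree `m`
with `Φ(x̄) ∈ (ϖ) + 𝔪^{m+1}` (its reduction modulo `ϖ` has order `> m`) has all its coefficients in `(x̄) + (ϖ) = 𝔪`.
[cite: Matsumura1987, §16 Definition p. 124, Thm. 14.2] [OURS · L1 W4.5b] -/
theorem coeff_mem_of_eval_mem_sup_pow (h3 : ringKrullDim A = (3 : ℕ)) (xb : Fin 2 → A) {ϖ : A} (hϖ : ϖ ∈ maximalIdeal A)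
    (hϖ2 : ϖ ∉ maximalIdeal A ^ 2) (h𝔪 : Ideal.span (Set.range xb) ⊔ Ideal.span {ϖ} = maximalIdeal A) {m : ℕ}
    {Φ : MvPolynomial (Fin 2) A} (hΦ : Φ.IsHomogeneous m) (hg : MvPolynomial.eval xb Φ ∈ Ideal.span {ϖ} ⊔ maximalIdeal A ^ (m + 1))
    (α : Fin 2 →₀ ℕ) : Φ.coeff α ∈ Ideal.span (Set.range xb) ⊔ Ideal.span {ϖ} := by
  classical
  set π := Ideal.Quotient.mk (Ideal.span ({ϖ} : Set A)) with hπ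
  have hπϖ : π ϖ = 0 := Ideal.Quotient.eq_zero_iff_mem.mpr (Ideal.mem_span_singleton_self _)
  have hmax₂ : (maximalIdeal A).map π = (Ideal.span (Set.range xb)).map π := by
    rw [← h𝔪, Ideal.map_sup, Ideal.map_span _ {ϖ}, Set.image_singleton, hπϖ, Ideal.span_singleton_eq_bot.mpr rfl, sup_bot_eq]
  have hgbar : π (MvPolynomial.eval xb Φ) ∈ (Ideal.span (Set.range xb)).map π ^ (m + 1) := by
    have h2 : π (MvPolynomial.eval xb Φ) ∈ (Ideal.span {ϖ} ⊔ maximalIdeal A ^ (m + 1)).map π := Ideal.mem_map_of_mem π hg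
    rw [Ideal.map_sup, Ideal.map_span _ {ϖ}, Set.image_singleton, hπϖ, Ideal.span_singleton_eq_bot.mpr rfl, bot_sup_eq,
      Ideal.map_pow, hmax₂] at h2
    exact h2
  exact coeff_mem_sup_span_of_eval_mem xb ϖ (isQuasiRegular_mk_of_sup_span_eq h3 xb hϖ hϖ2 h𝔪) hΦ hgbar α

/-- If every coefficient of a form `Φ` of degree `m` lies in `I = (x)`, then `Φ(x) ∈ I^{m+1}`. [folklore] -/
theorem eval_mem_pow_succ_of_map_eq_zero {R : Type u} [CommRing R] {ι : Type*} (x : ι → R) {m : ℕ} {Φ : MvPolynomial ι R}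
    (hΦ : Φ.IsHomogeneous m) (h0 : MvPolynomial.map (Ideal.Quotient.mk (Ideal.span (Set.range x))) Φ = 0) :
    MvPolynomial.eval x Φ ∈ Ideal.span (Set.range x) ^ (m + 1) := by
  classical
  have hcoeff : ∀ α, Φ.coeff α ∈ Ideal.span (Set.range x) := fun α => by
    have h1 := congrArg (MvPolynomial.coeff α) h0
    rw [MvPolynomial.coeff_map, MvPolynomial.coeff_zero] at h1
    exact Ideal.Quotient.eq_zero_iff_mem.mp h1
  have hmem : Φ ∈ Ideal.map (MvPolynomial.C : R →+* MvPolynomial ι R) (Ideal.span (Set.range x)) := by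
    rw [MvPolynomial.as_sum Φ]
    refine Ideal.sum_mem _ fun α _ => ?_
    rw [MvPolynomial.monomial_eq, mul_comm]
    exact Ideal.mul_mem_left _ _ (Ideal.mem_map_of_mem _ (hcoeff α))
  have h := eval_mem_mul_span_pow x hΦ hmem
  rw [pow_succ']
  exact h

end Algebra

/-! ## The comparable chart primes from the stalk data (the algebra at `R = 𝒪_{X,q}`) -/

section StalkData

/-- **The chart primes from the stalk data.** `X` a scheme, `𝔇`, `K` ideal sheaves, `z` a point of `V(𝔇)` with `R = 𝒪_{X, ι z}` regular of
dimension `4`; `c₀ ∈ 𝔪 ∖ 𝔪²`, `ϖ ∈ 𝔪 ∖ (𝔪² + (c₀))`, `K_{ι z} = (c₀, x₁, x₂)` with `(c₀, x₁, x₂) + (ϖ) = 𝔪` and `R/(c₀, x₁, x₂)` a domain;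
`𝔓 = 𝔇_{ι z}` prime with `c₀ ∈ 𝔓`, `dim R/𝔓 = 2`. If `𝔓 ≤ (c₀) + (c₀, x₁, x₂)^m`, `𝔓 ⊄ (c₀) + (c₀, x₁, x₂)^{m+1}` and `𝔓 ≤ (c₀) + (ϖ) + 𝔪^{m+1}`
(order exactly `m` along the section but `> m` at the point), then the chart algebra `𝒪_{V(𝔇),z}[K_z/c'_0]` of the restricted centre has two
comparable distinct primes over `𝔪_z` (part (iv)(c-2) over res-L1-w45b-stub-2's ring core, in `A = R/(c₀)` with `𝔓̄ = (g)`).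
[cite: Matsumura1987, Thm. 14.2, §16; GortzWedhorn2020, Prop. 13.96 (2)] [OURS · L1 W4.5b] -/
theorem exists_chartPrimes_of_stalkData {X : Scheme.{0}} (𝔇 K : X.IdealSheafData) (z : ↥𝔇.subscheme)
    [IsRegularLocalRing (X.presheaf.stalk (𝔇.subschemeι z))] (h4 : ringKrullDim (X.presheaf.stalk (𝔇.subschemeι z)) = (4 : ℕ))
    (c₀ ϖ x₁ x₂ : X.presheaf.stalk (𝔇.subschemeι z)) (hc₀ : c₀ ∈ maximalIdeal _) (hc₀2 : c₀ ∉ maximalIdeal _ ^ 2)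
    (hϖ : ϖ ∈ maximalIdeal _) (hϖ2 : ϖ ∉ maximalIdeal _ ^ 2 ⊔ Ideal.span {c₀})
    (hK : stalkIdeal K (𝔇.subschemeι z) = Ideal.span {c₀, x₁, x₂})
    (h𝔪 : Ideal.span {c₀, x₁, x₂} ⊔ Ideal.span {ϖ} = maximalIdeal (X.presheaf.stalk (𝔇.subschemeι z)))
    (hdom : IsDomain (X.presheaf.stalk (𝔇.subschemeι z) ⧸ Ideal.span {c₀, x₁, x₂}))
    (hprime : (stalkIdeal 𝔇 (𝔇.subschemeι z)).IsPrime) (hc𝔓 : c₀ ∈ stalkIdeal 𝔇 (𝔇.subschemeι z))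
    (h2 : ringKrullDim (X.presheaf.stalk (𝔇.subschemeι z) ⧸ stalkIdeal 𝔇 (𝔇.subschemeι z)) = (2 : ℕ)) {m : ℕ}
    (hIH : stalkIdeal 𝔇 (𝔇.subschemeι z) ≤ Ideal.span {c₀} ⊔ Ideal.span {c₀, x₁, x₂} ^ m)
    (hnot : ¬ stalkIdeal 𝔇 (𝔇.subschemeι z) ≤ Ideal.span {c₀} ⊔ Ideal.span {c₀, x₁, x₂} ^ (m + 1))
    (hn : stalkIdeal 𝔇 (𝔇.subschemeι z) ≤ Ideal.span {c₀} ⊔ Ideal.span {ϖ} ⊔ maximalIdeal _ ^ (m + 1)) :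
    ∃ (c : Fin 2 → 𝔇.subscheme.presheaf.stalk z) (_ : Ideal.span (Set.range c) = stalkIdeal (K.comap 𝔇.subschemeι) z)
      (𝔔₁ 𝔔₀ : PrimeSpectrum (blowupAlgebra (Ideal.span (Set.range c)) (c 0))),
      𝔔₁.asIdeal.comap (algebraMap _ (blowupAlgebra (Ideal.span (Set.range c)) (c 0))) =
        maximalIdeal (𝔇.subscheme.presheaf.stalk z) ∧
      𝔔₀.asIdeal.comap (algebraMap _ (blowupAlgebra (Ideal.span (Set.range c)) (c 0))) =
        maximalIdeal (𝔇.subscheme.presheaf.stalk z) ∧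
      𝔔₁.asIdeal ≤ 𝔔₀.asIdeal ∧ 𝔔₁ ≠ 𝔔₀ := by
  classical
  haveI := hprime
  haveI := hdom
  -- the carrier germ `A = R/(c₀)`
  obtain ⟨hA, hdimA⟩ := IsRegularLocalRing.quotient_span_singleton hc₀ hc₀2
  haveI := hA
  let ρ := Ideal.Quotient.mk (Ideal.span ({c₀} : Set (X.presheaf.stalk (𝔇.subschemeι z))))
  have hsurjρ : Function.Surjective ρ := Ideal.Quotient.mk_surjective
  have h3 : ringKrullDim (X.presheaf.stalk (𝔇.subschemeι z) ⧸ Ideal.span {c₀}) = (3 : ℕ) := by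
    obtain ⟨n, hn'⟩ := exists_nat_cast_eq_ringKrullDim (R := X.presheaf.stalk (𝔇.subschemeι z) ⧸ Ideal.span {c₀})
    rw [hn', h4] at hdimA
    rw [hn']
    have h' : ((n + 1 : ℕ) : WithBot ℕ∞) = ((4 : ℕ) : WithBot ℕ∞) := by rw [← hdimA]; push_cast; rfl
    have h'' : n + 1 = 4 := by exact_mod_cast h'
    have : n = 3 := by omega
    rw [this]
  have hρc₀ : ρ c₀ = 0 := Ideal.Quotient.eq_zero_iff_mem.mpr (Ideal.mem_span_singleton_self c₀)
  have hmaxA : (maximalIdeal _).map ρ = maximalIdeal _ := map_maximalIdeal_of_surjective ρ hsurjρ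
  -- the section coordinates `x̄ = (x̄₁, x̄₂)` of `A`
  let xb : Fin 2 → X.presheaf.stalk (𝔇.subschemeι z) ⧸ Ideal.span {c₀} := ![ρ x₁, ρ x₂]
  have hr2 : ∀ {α : Type} (a b : α), Set.range ![a, b] = {a, b} := fun a b => by
    ext y
    simp only [Set.mem_range, Set.mem_insert_iff, Set.mem_singleton_iff]
    constructor
    · rintro ⟨i, rfl⟩
      fin_cases i
      · exact Or.inl rfl
      · exact Or.inr rfl
    · rintro (rfl | rfl)
      · exact ⟨0, rfl⟩
      · exact ⟨1, rfl⟩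
  have hxbspan : Ideal.span (Set.range xb) = (Ideal.span {c₀, x₁, x₂}).map ρ := by
    rw [hr2, Ideal.map_span, Set.image_insert_eq, Set.image_pair, hρc₀, Ideal.span_insert_zero]
  have h𝔪A : Ideal.span (Set.range xb) ⊔ Ideal.span {ρ ϖ} = maximalIdeal _ := by
    rw [← hmaxA, ← h𝔪, Ideal.map_sup, ← hxbspan, Ideal.map_span, Set.image_singleton]
  haveI : (Ideal.span (Set.range xb) ⊔ Ideal.span {ρ ϖ}).IsPrime := by rw [h𝔪A]; exact (maximalIdeal.isMaximal _).isPrime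
  -- `x̄` is quasi-regular (the tail of the frame `(c₀, x₁, x₂)`) and `A/(x̄) ≅ R/(c₀, x₁, x₂)` is a domain
  have hr3 : Set.range ![c₀, x₁, x₂] = {c₀, x₁, x₂} := range_fin_three _
  have h22 : ringKrullDim (X.presheaf.stalk (𝔇.subschemeι z)) = (2 + 2 : ℕ) := h4
  have hxbq : IsQuasiRegular xb := by
    have h := isQuasiRegular_tail_of_sup_span_singleton_eq ![c₀, x₁, x₂] ϖ (by rw [hr3]; exact h𝔪) h22
    have e : (fun l : Fin 2 => Ideal.Quotient.mk (Ideal.span {(![c₀, x₁, x₂] : Fin 3 → _) 0})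
        ((![c₀, x₁, x₂] : Fin 3 → X.presheaf.stalk (𝔇.subschemeι z)) l.succ)) = xb := by
      funext l
      fin_cases l <;> rfl
    rw [e] at h
    exact h
  haveI hdomA : IsDomain ((X.presheaf.stalk (𝔇.subschemeι z) ⧸ Ideal.span {c₀}) ⧸ Ideal.span (Set.range xb)) := by
    have hJ : Ideal.span (Set.range xb) = (Ideal.span {x₁, x₂}).map ρ := by
      rw [hr2, Ideal.map_span, Set.image_pair]
    have e : ((X.presheaf.stalk (𝔇.subschemeι z) ⧸ Ideal.span {c₀}) ⧸ Ideal.span (Set.range xb)) ≃+*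
        X.presheaf.stalk (𝔇.subschemeι z) ⧸ Ideal.span {c₀, x₁, x₂} := by
      refine (Ideal.quotEquivOfEq hJ).trans ((DoubleQuot.quotQuotEquivQuotSup _ _).trans (Ideal.quotEquivOfEq ?_))
      exact (Ideal.span_insert c₀ {x₁, x₂}).symm
    exact e.toMulEquiv.isDomain
  -- `ϖ̄` a regular parameter of `A`; `x̄` quasi-regular modulo `ϖ̄`
  have hϖA : ρ ϖ ∈ maximalIdeal _ := by rw [← hmaxA]; exact Ideal.mem_map_of_mem _ hϖ
  have hϖA2 : ρ ϖ ∉ maximalIdeal _ ^ 2 := by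
    intro h
    rw [← hmaxA, ← Ideal.map_pow, Ideal.mem_map_iff_of_surjective ρ hsurjρ] at h
    obtain ⟨y, hy, hyϖ⟩ := h
    apply hϖ2
    have hdiff : ϖ - y ∈ Ideal.span {c₀} := by rw [← Ideal.Quotient.eq, hyϖ]
    have : ϖ = y + (ϖ - y) := by ring
    rw [this]
    exact Submodule.add_mem_sup hy hdiff
  -- the prime `𝔭 = 𝔓/(c₀) = (g)` of `D♭` in the carrier germ
  haveI h𝔭 : ((stalkIdeal 𝔇 (𝔇.subschemeι z)).map ρ).IsPrime :=
    Ideal.map_isPrime_of_surjective hsurjρ (by rw [Ideal.mk_ker]; exact (Ideal.span_singleton_le_iff_mem _).mpr hc𝔓)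
  have h2A : ringKrullDim ((X.presheaf.stalk (𝔇.subschemeι z) ⧸ Ideal.span {c₀}) ⧸ (stalkIdeal 𝔇 (𝔇.subschemeι z)).map ρ) = (2 : ℕ) := by
    rw [ringKrullDim_eq_of_ringEquiv (DoubleQuot.quotQuotEquivQuotOfLE ((Ideal.span_singleton_le_iff_mem _).mpr hc𝔓)), h2]
  obtain ⟨g, -, hg𝔭⟩ := exists_prime_span_singleton_eq_of_ringKrullDim_quotient h3 _ h2A
  -- `φ_A : A ↠ 𝒪_{V(𝔇), z}` with kernel `(g)`
  have hsurjφ : Function.Surjective (𝔇.subschemeι.stalkMap z).hom := 𝔇.subschemeι.stalkMap_surjective z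
  have hkerφ : RingHom.ker (𝔇.subschemeι.stalkMap z).hom = stalkIdeal 𝔇 (𝔇.subschemeι z) := by
    have h := (stalkIdeal_ker_eq_ker_stalkMap 𝔇.subschemeι z).symm
    rw [Scheme.IdealSheafData.ker_subschemeι] at h
    exact h
  let φA : (X.presheaf.stalk (𝔇.subschemeι z) ⧸ Ideal.span {c₀}) →+* 𝔇.subscheme.presheaf.stalk z :=
    Ideal.Quotient.lift (Ideal.span {c₀}) (𝔇.subschemeι.stalkMap z).hom fun a ha => by
      rw [← RingHom.mem_ker, hkerφ]
      exact (Ideal.span_singleton_le_iff_mem _).mpr hc𝔓 ha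
  have hφA : ∀ a, φA (ρ a) = (𝔇.subschemeι.stalkMap z).hom a := fun a => rfl
  have hφAsurj : Function.Surjective φA := fun y => by
    obtain ⟨a, ha⟩ := hsurjφ y
    exact ⟨ρ a, by rw [hφA, ha]⟩
  have hkerA : RingHom.ker φA = Ideal.span {g} := by
    rw [← hg𝔭, ← hkerφ]
    exact Ideal.ker_quotient_lift _ _
  haveI : IsLocalRing (𝔇.subscheme.presheaf.stalk z) := inferInstance
  have h𝔪S : (Ideal.span (Set.range xb) ⊔ Ideal.span {ρ ϖ}).map φA = maximalIdeal _ := by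
    rw [h𝔪A]; exact map_maximalIdeal_of_surjective φA hφAsurj
  -- `g ∈ (x̄)^m`, `g ∉ (x̄)^{m+1}`, `ḡ ∈ 𝔪̄^{m+1}`
  have hg𝔭' : g ∈ (stalkIdeal 𝔇 (𝔇.subschemeι z)).map ρ := by rw [hg𝔭]; exact Ideal.mem_span_singleton_self g
  have hgm : g ∈ Ideal.span (Set.range xb) ^ m := by
    have h1 := Ideal.map_mono (f := ρ) hIH
    rw [Ideal.map_sup, Ideal.map_span, Set.image_singleton, hρc₀, Ideal.span_singleton_eq_bot.mpr rfl, bot_sup_eq,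
      Ideal.map_pow, ← hxbspan] at h1
    exact h1 hg𝔭'
  have hgnot : g ∉ Ideal.span (Set.range xb) ^ (m + 1) := by
    intro hgm1
    apply hnot
    intro p hp
    have h1 : ρ p ∈ (Ideal.span {c₀, x₁, x₂} ^ (m + 1)).map ρ := by
      rw [Ideal.map_pow, ← hxbspan]
      have h2 : ρ p ∈ Ideal.span {g} := by rw [← hg𝔭]; exact Ideal.mem_map_of_mem _ hp
      exact (Ideal.span_singleton_le_iff_mem _ |>.mpr hgm1) h2
    rw [Ideal.mem_map_iff_of_surjective ρ hsurjρ] at h1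
    obtain ⟨y, hy, hyp⟩ := h1
    have hdiff : p - y ∈ Ideal.span {c₀} := by rw [← Ideal.Quotient.eq]; exact hyp.symm
    have : p = (p - y) + y := by ring
    rw [this]
    exact Submodule.add_mem_sup hdiff hy
  have hg1 : g ∈ Ideal.span {ρ ϖ} ⊔ maximalIdeal (X.presheaf.stalk (𝔇.subschemeι z) ⧸ Ideal.span {c₀}) ^ (m + 1) := by
    have h := Ideal.map_mono (f := ρ) hn
    rw [Ideal.map_sup, Ideal.map_sup, Ideal.map_span _ {c₀}, Set.image_singleton, hρc₀, Ideal.span_singleton_eq_bot.mpr rfl,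
      bot_sup_eq, Ideal.map_span _ {ϖ}, Set.image_singleton, Ideal.map_pow, hmaxA] at h
    exact h hg𝔭'
  -- the cone form `Φ` of `g` and the coefficient criterion
  obtain ⟨Φ, hΦd, hΦev⟩ := exists_isHomogeneous_of_mem_span_pow xb m hgm
  have hΦne : MvPolynomial.map (Ideal.Quotient.mk (Ideal.span (Set.range xb))) Φ ≠ 0 := fun h0 =>
    hgnot (hΦev ▸ eval_mem_pow_succ_of_map_eq_zero xb hΦd h0)
  have hΦi : MvPolynomial.map (Ideal.Quotient.mk (Ideal.span (Set.range xb))) (dehomogenize 0 Φ) ≠ 0 := by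
    rw [map_dehomogenize]
    exact dehomogenize_ne_zero_of_isHomogeneous 0 (hΦd.map _) hΦne
  have hΦcoeff := coeff_mem_of_eval_mem_sup_pow h3 xb hϖA hϖA2 h𝔪A hΦd (by rw [hΦev]; exact hg1)
  have hkerA' : RingHom.ker φA = Ideal.span {MvPolynomial.eval xb Φ} := by rw [hΦev]; exact hkerA
  obtain ⟨𝔔₁, 𝔔₀, h1, h0, hle, hne⟩ :=
    exists_chartPrimes_of_forall_coeff_mem xb 0 (ρ ϖ) hxbq ⟨1, by decide⟩ Φ hΦd hΦi hΦcoeff φA hφAsurj hkerA' h𝔪S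
  -- the generators of the restricted centre at `z`
  have hc : Ideal.span (Set.range fun l => φA (xb l)) = stalkIdeal (K.comap 𝔇.subschemeι) z := by
    have hφc₀ : (𝔇.subschemeι.stalkMap z).hom c₀ = 0 := by
      have : c₀ ∈ RingHom.ker (𝔇.subschemeι.stalkMap z).hom := by rw [hkerφ]; exact hc𝔓
      exact this
    have hfun : (fun l => φA (xb l)) = ![(𝔇.subschemeι.stalkMap z).hom x₁, (𝔇.subschemeι.stalkMap z).hom x₂] := by
      funext l
      fin_cases l <;> rfl
    rw [stalkIdeal_comap_eq_map_stalkMap 𝔇.subschemeι K z, hK, Ideal.map_span, Set.image_insert_eq, Set.image_pair, hφc₀,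
      Ideal.span_insert_zero, hfun, hr2]
  exact ⟨fun l => φA (xb l), hc, 𝔔₁, 𝔔₀, h1, h0, hle, hne⟩

end StalkData

end Summit.ResolutionOfSingularities.ResolutionOfSingularities.Cruxes.EquisingularLiftNat.Sections

end
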